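import Summits.QuantumFields.YangMills.Theorems.UnitScaleTiltProp8IterPlaqSmallAllLCluster
import Summits.QuantumFields.YangMills.Theorems.UnitScaleTiltProp8ChartCovariance
import Summits.QuantumFields.YangMills.Theorems.UnitScaleTiltProp8ChartTransport
import Summits.QuantumFields.YangMills.Theorems.UnitScaleTiltProp8FibreTangentAvg
import HarnessLib

/-!
# Route `UnitScaleTilt`, crux K1 child «MinimiserStabilityRegPr» (stmt-QuantumFields-19200), stub `stub_existenceMinimalOrbit` (EX), route (α), node (AVG-SYM) —
# (AVG-SYM-BD): **THE k-UNIFORM SUP BOUND OF THE RELATIVE k-FOLD (0.4) AVERAGE `Ū^{(k)}[e^{iηA}U₀]·(Ū^{(k)}[U₀])⁻¹` AT A CURVED, PLAQUETTE-SMALL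
# BACKGROUND `U₀`, FOR COMPLEX `A`** — the analytic input (BD) of ★w2-20520 g2's Schwarz reduction `Inputs ⇐ (AN) + (BD)` for the CHART-47 supplier
# `Chart47T3sym` (OWNER RULING g25-№3 §3(b)–(c)), by GAUGE COVARIANCE + THE CLUSTER AXIAL GAUGE over the ★19200-p2∕p1 `Prop8Chart*` machinery

Cell `ym3-torus`, width seat `ym-ust-20520-w4` (gen 2; OWNER ym3-torus-plan g25 02:47:05Z (3) «YOUR NEXT = (AVG-SYM-BD) … LOCATE + post the signature … before
typing»; LOCATED posted 03:2xZ).  YM₃ on T³ is a ladder rung (R3), NOT the Clay problem; nothing here is a claim about the stub, the crux, d = 4 or the mass gap.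
`--supports stmt-QuantumFields-19200 --as helper`; count-neutral.

THE PRINT.  [Balaban1987RG1] (0.4) p. 253 (the symmetric average) and p. 253: *«It is a Gᶜ-valued function … we assume that it is an analytic function»*;
[Balaban1985Averaging] Prop. 4 (134)–(135) p. 38 (the `k`-fold averages of a small field stay small, uniformly in `k`), (11)–(12) p. 19 (gauge covariance);
[Balaban1985Variational] (44) p. 285 *«|C_j(L^jηA)| ≤ C₂(L^jη)²|A|²»* (the chart's remainder — here its SUP-BOUND input at a curved background).

THE OBJECTS (all in the tree, ★19200-p2∕p1 lineage `…Theorems.Prop8Chart`): `expCfg η A : GaugeField P 0 𝔸ˣ` (`b ↦ e^{iηA(b)}`, complex `A`), `emlIterU k` = the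
`k`-fold UNGUARDED (0.4) average on `𝔸ˣ`-valued fields with print's `exp[mean log]` (`ExpMeanLog.eml`), `gaugeActT`, `transfUp`; the SU(2) background read in
`M₂(ℂ)ˣ` by `unitsField ∘ toUField`.

WHAT THIS FILE PROVES (sorry-free; no definition; composition BY NAME + [folklore] algebra).
* §1 (any complete normed ℂ-algebra) `norm_mul_inv_sub_one_le` (two near-`1` units ⇒ their quotient is near `1`); ★`norm_emlIterU_mul_inv_sub_one_le_of_reads`:
  two `𝔸ˣ`-fields `V₁, V₂` whose bonds under the `i`-blocks of a site set `S` are within `s₀` of `1`, budget `6400ℓ²Lⁱs₀ ≤ 1` ⟹ for every `i`-bond `e` with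
  ends in `S`, `‖Ū^{(i)}[V₁](e)·Ū^{(i)}[V₂](e)⁻¹ − 1‖ ≤ 4·(30ℓLⁱs₀)` (`Prop8Chart.norm_emlIterU_sub_one_le_of_reads` twice, ★19200-p2 g6).
* §2 ★`emlIterU_mul_inv_eq_conj`: under a gauge family `transfUp û`, the RELATIVE quantity `Ū^{(k)}[V₁](e)·Ū^{(k)}[V₂](e)⁻¹` is the CONJUGATE by `û^{(k)}(e₋)⁻¹` of the
  relative quantity of the gauged fields (`Prop8Chart.emlIterU_gaugeActT`).
* §3 (𝔸 = M₂(ℂ), SU(2) background) `gaugeActT_mul_bg` (`(e^{iηA}·U₀♭)^{û} = û₋e^{iηA}û₋⁻¹ · (U₀^u)♭` bondwise), `norm_reads_gauged_product_le` (its bonds are within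
  `s_A(1+s_B) + s_B` of `1` where `‖e^{iηA(b)} − 1‖ ≤ s_A` and `‖(U₀^u)♭(b) − 1‖ ≤ s_B`), `norm_conj_su_le` (`Prop8Criticality.norm_coe_su2`);
  ★★**`norm_relIter_sub_one_le_of_plaqSmall`** — for `U₀ : GaugeField P 0 SU(2)` with `PlaqSmall a₀ U₀`, `k + 1 ≤ m + K`, complex `A` with `‖ηA(b)‖ ≤ t ≤ 1`, and
  the budget `6400ℓ²Lᵏ·s₀ ≤ 1` at `s₀ := 2t(1 + s_B) + s_B`, `s_B := 2d(3Lᵏ−1)a₀`: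
  `‖Ū^{(k)}[e^{iηA}U₀♭](e)·(Ū^{(k)}[U₀♭](e))⁻¹ − 1‖ ≤ 120ℓ·Lᵏ·s₀` for EVERY `k`-bond `e` — with EX's scaling `η = L^{−k}`, `a₀ = εL^{−2k}`: `Lᵏs₀ = O(‖A‖ + dε)`,
  k-FREE.  Proof: the cluster axial gauge `u = axialT U₀ (embIter k e₋)` (`IterPlaqSmallAllL.dist1_axial_cluster_le`, ★p1 g18), §3's reads, §1, §2 (unitary conjugation
  is an isometry of `M₂(ℂ)`).
HONEST SCOPE.  The bound is CRUDE (linear in the reads, no second-order structure) — exactly what (BD) asks: with (AN) (`Prop8ChartDiffBall`-type analyticity) and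
`CmapSym 0 = 0`, `D CmapSym(0) = 0` the Schwarz lemma (★w2-20520 g2's FILE 1) turns it into `B11Prop3Model.Inputs`' (44)∕(72).  `CmapSym` itself (★w1-19200 g2:
`mlog` of this relative quantity at `fieldShift e`, minus its linearisation) is NOT defined here; the (0.4) average is the UNGUARDED complex one (its agreement with
the route's `descendTo` on regular SU(2) fields is `Prop8ChartBridge.coe_emlIterU_unitsField`, ★w3-20520 g2's (J)).  Nothing of [Balaban1985Averaging] is
re-proved: every estimate is the `Prop8Chart*` lineage's, composed.

References: T. Bałaban, CMP **109** (1987) 249–301 [Balaban1987RG1] ((0.4)–(0.11) p.253); CMP **98** (1985) 17–51 [Balaban1985Averaging] ((11)–(12) p.19, p.24,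
Prop. 4 (134)–(135) p.38); CMP **102** (1985) 277–309 [Balaban1985Variational] ((44) p.285, (145)–(146) p.301, (152) p.301).
-/

noncomputable section

open scoped BigOperators
open NormedSpace

namespace Summit.QuantumFields.YangMills.Theorems.Prop7SymAvgRelativeBound

open Literature.MathematicalPhysics.QuantumFieldTheory.Balaban1983to89
open T4Continuum BlockAveraging
open B5Eq118OneStroke (iterBlockOf)
open B15DeterminingSets (embIter)
open B10Eq27TorusAxialLog (axialT gaugeActT gaugeActT_apply unitsField toUField suIncl)
open Summit.QuantumFields.YangMills.Theorems.Prop8Chart (expCfg coe_expCfg emlIterU emlIterU_gaugeActT norm_emlIterU_sub_one_le_of_reads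
  coe_unitsField_toUField norm_inv_sub_one_le_two_mul)
open B7TransferAnalyticMean (norm_exp_sub_one_le_two_mul)
open Summit.QuantumFields.YangMills.Theorems.IterPlaqSmallAllL (dist1_axial_cluster_le)
open Summit.QuantumFields.YangMills.Theorems.Prop8Criticality (norm_coe_su2)

variable {P : Params}

/-! ## §1 Two fields with small reads: the relative iterate is near `1` -/

section Generic

variable {𝔸 : Type*} [NormedRing 𝔸] [NormedAlgebra ℂ 𝔸] [CompleteSpace 𝔸] [NormOneClass 𝔸]

omit [NormedAlgebra ℂ 𝔸] [CompleteSpace 𝔸] in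
/-- **QUOTIENT OF TWO NEAR-`1` UNITS**: `‖X − 1‖ ≤ x`, `‖Y − 1‖ ≤ y ≤ ½` ⟹ `‖XY⁻¹ − 1‖ ≤ (1 + x)(1 + 2y) − 1`. [folklore] -/
theorem norm_mul_inv_sub_one_le {X Y : 𝔸ˣ} {x y : ℝ} (hX : ‖(X : 𝔸) - 1‖ ≤ x) (hY : ‖(Y : 𝔸) - 1‖ ≤ y) (hy : y ≤ 1 / 2) :
    ‖(X : 𝔸) * ((Y⁻¹ : 𝔸ˣ) : 𝔸) - 1‖ ≤ (1 + x) * (1 + 2 * y) - 1 := by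
  have hx0 : 0 ≤ x := (norm_nonneg _).trans hX
  have hY' : ‖((Y⁻¹ : 𝔸ˣ) : 𝔸) - 1‖ ≤ 2 * y := norm_inv_sub_one_le_two_mul hY hy
  have e : (X : 𝔸) * ((Y⁻¹ : 𝔸ˣ) : 𝔸) - 1 = ((X : 𝔸) - 1) * (((Y⁻¹ : 𝔸ˣ) : 𝔸) - 1) + ((X : 𝔸) - 1) + (((Y⁻¹ : 𝔸ˣ) : 𝔸) - 1) := by
    noncomm_ring
  rw [e]
  have h1 : ‖((X : 𝔸) - 1) * (((Y⁻¹ : 𝔸ˣ) : 𝔸) - 1)‖ ≤ x * (2 * y) := (norm_mul_le _ _).trans (mul_le_mul hX hY' (norm_nonneg _) hx0)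
  calc _ ≤ ‖((X : 𝔸) - 1) * (((Y⁻¹ : 𝔸ˣ) : 𝔸) - 1)‖ + ‖(X : 𝔸) - 1‖ + ‖((Y⁻¹ : 𝔸ˣ) : 𝔸) - 1‖ := norm_add₃_le
    _ ≤ x * (2 * y) + x + 2 * y := by linarith
    _ = (1 + x) * (1 + 2 * y) - 1 := by ring

/-- **THE RELATIVE `i`-FOLD AVERAGE OF TWO FIELDS WITH SMALL READS** (both within `s₀` of `1` under the `i`-blocks of `S`, budget `6400ℓ²Lⁱs₀ ≤ 1`): for every
`i`-bond `e` with both ends in `S`, `‖Ū^{(i)}[V₁](e)·Ū^{(i)}[V₂](e)⁻¹ − 1‖ ≤ 120ℓLⁱs₀` (`(1 + 30x)(1 + 60x) − 1 ≤ 120x` for `x = ℓLⁱs₀ ≤ 1/6400`).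
[cite: Balaban1985Averaging, Prop. 4 (134)-(135) p.38] -/
theorem norm_emlIterU_mul_inv_sub_one_le_of_reads {i : ℕ} (hi : i ≤ P.m + P.K) (S : Set (Site P i)) (V₁ V₂ : GaugeField P 0 𝔸ˣ) {s₀ : ℝ} (hs₀ : 0 ≤ s₀)
    (hbudget : 6400 * (((P.d + 2) * P.L : ℕ) : ℝ) ^ 2 * (P.L : ℝ) ^ i * s₀ ≤ 1)
    (h₁ : ∀ b : PBond P 0, iterBlockOf i b.src ∈ S → iterBlockOf i b.tgt ∈ S → ‖((V₁ b : 𝔸ˣ) : 𝔸) - 1‖ ≤ s₀)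
    (h₂ : ∀ b : PBond P 0, iterBlockOf i b.src ∈ S → iterBlockOf i b.tgt ∈ S → ‖((V₂ b : 𝔸ˣ) : 𝔸) - 1‖ ≤ s₀)
    (e : PBond P i) (hs : e.src ∈ S) (ht : e.tgt ∈ S) :
    ‖((emlIterU i V₁ e : 𝔸ˣ) : 𝔸) * (((emlIterU i V₂ e)⁻¹ : 𝔸ˣ) : 𝔸) - 1‖ ≤ 120 * (((P.d + 2) * P.L : ℕ) : ℝ) * (P.L : ℝ) ^ i * s₀ := by
  set ℓ : ℝ := (((P.d + 2) * P.L : ℕ) : ℝ) with hℓ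
  have hℓ1 : (1 : ℝ) ≤ ℓ := by
    rw [hℓ]; exact_mod_cast Nat.one_le_iff_ne_zero.mpr (Nat.mul_ne_zero (by omega) (by have := P.hL.2; omega))
  set x : ℝ := ℓ * (P.L : ℝ) ^ i * s₀ with hx
  have hx0 : 0 ≤ x := by positivity
  have hxs : 6400 * ℓ * x ≤ 1 := by rw [hx]; nlinarith [hbudget]
  have hx1 : x ≤ 1 / 6400 := by nlinarith
  have hX := norm_emlIterU_sub_one_le_of_reads hi S V₁ hs₀ hbudget h₁ e hs ht
  have hY := norm_emlIterU_sub_one_le_of_reads hi S V₂ hs₀ hbudget h₂ e hs ht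
  have hX' : ‖((emlIterU i V₁ e : 𝔸ˣ) : 𝔸) - 1‖ ≤ 30 * x := by rw [hx]; linarith
  have hY' : ‖((emlIterU i V₂ e : 𝔸ˣ) : 𝔸) - 1‖ ≤ 30 * x := by rw [hx]; linarith
  refine (norm_mul_inv_sub_one_le hX' hY' (by linarith)).trans ?_
  have : (1 + 30 * x) * (1 + 2 * (30 * x)) - 1 ≤ 120 * x := by nlinarith
  rw [hx] at this
  linarith

/-! ## §2 Gauge covariance of the relative quantity -/

omit [NormOneClass 𝔸] in
/-- **THE RELATIVE ITERATE UNDER A GAUGE FAMILY**: for `û : T^{(0)} → 𝔸ˣ` and its block-centre lifts `transfUp û`,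
`Ū^{(k)}[V₁](e)·Ū^{(k)}[V₂](e)⁻¹ = û^{(k)}(e₋)⁻¹ · (Ū^{(k)}[V₁^{û}](e)·Ū^{(k)}[V₂^{û}](e)⁻¹) · û^{(k)}(e₋)` — a CONJUGATE of the gauged relative quantity
(`Prop8Chart.emlIterU_gaugeActT`). [cite: Balaban1985Averaging, (11)-(12) p.19] -/
theorem emlIterU_mul_inv_eq_conj (û : GaugeTransf P 0 𝔸ˣ) (V₁ V₂ : GaugeField P 0 𝔸ˣ) (k : ℕ) (e : PBond P k) :
    ((emlIterU k V₁ e : 𝔸ˣ) : 𝔸) * (((emlIterU k V₂ e)⁻¹ : 𝔸ˣ) : 𝔸) =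
      (((transfUp û k e.src)⁻¹ : 𝔸ˣ) : 𝔸) *
        (((emlIterU k (gaugeActT û V₁) e : 𝔸ˣ) : 𝔸) * (((emlIterU k (gaugeActT û V₂) e)⁻¹ : 𝔸ˣ) : 𝔸)) * ((transfUp û k e.src : 𝔸ˣ) : 𝔸) := by
  have hus : ∀ (i : ℕ) (y : Site P (i + 1)), transfUp û (i + 1) y = transfUp û i (emb y) := fun _ _ => rfl
  have h₁ : emlIterU k (gaugeActT û V₁) e = transfUp û k e.src * emlIterU k V₁ e * (transfUp û k e.tgt)⁻¹ := by
    rw [show gaugeActT û V₁ = gaugeActT (transfUp û 0) V₁ from rfl, emlIterU_gaugeActT (transfUp û) hus V₁ k, gaugeActT_apply]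
  have h₂ : emlIterU k (gaugeActT û V₂) e = transfUp û k e.src * emlIterU k V₂ e * (transfUp û k e.tgt)⁻¹ := by
    rw [show gaugeActT û V₂ = gaugeActT (transfUp û 0) V₂ from rfl, emlIterU_gaugeActT (transfUp û) hus V₂ k, gaugeActT_apply]
  have key : emlIterU k V₁ e * (emlIterU k V₂ e)⁻¹ =
      (transfUp û k e.src)⁻¹ * (emlIterU k (gaugeActT û V₁) e * (emlIterU k (gaugeActT û V₂) e)⁻¹) * transfUp û k e.src := by
    rw [h₁, h₂]; group
  have := congrArg (fun z : 𝔸ˣ => (z : 𝔸)) key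
  simpa only [Units.val_mul] using this

end Generic

/-! ## §3 The SU(2) background in the cluster axial gauge -/

section SU2

open scoped Matrix.Norms.L2Operator

/-- The `M₂(ℂ)ˣ` reading of an `SU(2)` gauge transformation: `û(x) := toUnits (suIncl (u x))`, its matrix is `u(x)`. [folklore] -/
theorem coe_toUnits_suIncl (g : Matrix.specialUnitaryGroup (Fin 2) ℂ) :
    ((Unitary.toUnits (suIncl g) : (Matrix (Fin 2) (Fin 2) ℂ)ˣ) : Matrix (Fin 2) (Fin 2) ℂ) = (g : Matrix (Fin 2) (Fin 2) ℂ) := rfl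

/-- Its matrix has norm `1`. [folklore] -/
theorem norm_coe_toUnits_suIncl (g : Matrix.specialUnitaryGroup (Fin 2) ℂ) :
    ‖((Unitary.toUnits (suIncl g) : (Matrix (Fin 2) (Fin 2) ℂ)ˣ) : Matrix (Fin 2) (Fin 2) ℂ)‖ = 1 := by
  rw [coe_toUnits_suIncl]; exact norm_coe_su2 g

/-- … and the matrix of its inverse is `u(x)⁻¹`, also of norm `1`. [folklore] -/
theorem norm_coe_toUnits_suIncl_inv (g : Matrix.specialUnitaryGroup (Fin 2) ℂ) :
    ‖(((Unitary.toUnits (suIncl g))⁻¹ : (Matrix (Fin 2) (Fin 2) ℂ)ˣ) : Matrix (Fin 2) (Fin 2) ℂ)‖ = 1 := by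
  rw [← map_inv, ← map_inv, coe_toUnits_suIncl]; exact norm_coe_su2 g⁻¹

/-- **CONJUGATION BY A UNITARY DOES NOT INCREASE THE NORM**: `‖û⁻¹·Z·û‖ ≤ ‖Z‖`. [folklore] -/
theorem norm_conj_su_le (g : Matrix.specialUnitaryGroup (Fin 2) ℂ) (Z : Matrix (Fin 2) (Fin 2) ℂ) :
    ‖(((Unitary.toUnits (suIncl g))⁻¹ : (Matrix (Fin 2) (Fin 2) ℂ)ˣ) : Matrix (Fin 2) (Fin 2) ℂ) * Z *
        ((Unitary.toUnits (suIncl g) : (Matrix (Fin 2) (Fin 2) ℂ)ˣ) : Matrix (Fin 2) (Fin 2) ℂ)‖ ≤ ‖Z‖ := by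
  calc _ ≤ ‖(((Unitary.toUnits (suIncl g))⁻¹ : (Matrix (Fin 2) (Fin 2) ℂ)ˣ) : Matrix (Fin 2) (Fin 2) ℂ) * Z‖ *
        ‖((Unitary.toUnits (suIncl g) : (Matrix (Fin 2) (Fin 2) ℂ)ˣ) : Matrix (Fin 2) (Fin 2) ℂ)‖ := norm_mul_le _ _
    _ ≤ ‖(((Unitary.toUnits (suIncl g))⁻¹ : (Matrix (Fin 2) (Fin 2) ℂ)ˣ) : Matrix (Fin 2) (Fin 2) ℂ)‖ * ‖Z‖ * 1 := by
        gcongr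
        · exact norm_mul_le _ _
        · exact (norm_coe_toUnits_suIncl g).le
    _ = ‖Z‖ := by rw [norm_coe_toUnits_suIncl_inv, one_mul, mul_one]

/-- **THE GAUGED BACKGROUND READ IN `M₂(ℂ)ˣ`**: `(U₀^u)♭ = (U₀♭)^{û}`. [cite: Balaban1985Averaging, (8) p.19, (19) p.21] -/
theorem unitsField_toUField_gaugeActT (u : GaugeTransf P 0 (Matrix.specialUnitaryGroup (Fin 2) ℂ))
    (U₀ : GaugeField P 0 (Matrix.specialUnitaryGroup (Fin 2) ℂ)) :
    unitsField (toUField (gaugeActT u U₀)) = gaugeActT (fun x => Unitary.toUnits (suIncl (u x))) (unitsField (toUField U₀)) := by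
  funext b
  simp only [unitsField, toUField, gaugeActT_apply, map_mul, map_inv]

/-- **THE GAUGED PERTURBED FIELD**: `(e^{iηA}·U₀♭)^{û}(b) = û(b₋)e^{iηA(b)}û(b₋)⁻¹ · (U₀♭)^{û}(b)`. [cite: Balaban1985Averaging, (8) p.19] -/
theorem gaugeActT_mul_bg (û : GaugeTransf P 0 (Matrix (Fin 2) (Fin 2) ℂ)ˣ) (E V : GaugeField P 0 (Matrix (Fin 2) (Fin 2) ℂ)ˣ) (b : PBond P 0) :
    gaugeActT û (fun b => E b * V b) b = (û b.src * E b * (û b.src)⁻¹) * gaugeActT û V b := by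
  rw [gaugeActT_apply, gaugeActT_apply]; group

/-- **READS OF THE GAUGED PERTURBED FIELD**: if `‖e^{iηA(b)} − 1‖ ≤ s_A` and the gauged background bond is within `s_B` of `1`, then the gauged perturbed bond is
within `s_A(1 + s_B) + s_B` of `1` (unitary conjugation is an isometry). [folklore] -/
theorem norm_reads_gauged_product_le (u : GaugeTransf P 0 (Matrix.specialUnitaryGroup (Fin 2) ℂ))
    (E V : GaugeField P 0 (Matrix (Fin 2) (Fin 2) ℂ)ˣ) (b : PBond P 0) {sA sB : ℝ}
    (hE : ‖((E b : (Matrix (Fin 2) (Fin 2) ℂ)ˣ) : Matrix (Fin 2) (Fin 2) ℂ) - 1‖ ≤ sA)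
    (hV : ‖((gaugeActT (fun x => Unitary.toUnits (suIncl (u x))) V b : (Matrix (Fin 2) (Fin 2) ℂ)ˣ) : Matrix (Fin 2) (Fin 2) ℂ) - 1‖ ≤ sB) :
    ‖((gaugeActT (fun x => Unitary.toUnits (suIncl (u x))) (fun b => E b * V b) b : (Matrix (Fin 2) (Fin 2) ℂ)ˣ) : Matrix (Fin 2) (Fin 2) ℂ) - 1‖ ≤
      sA * (1 + sB) + sB := by
  have hsA : 0 ≤ sA := (norm_nonneg _).trans hE
  have hval : ((gaugeActT (fun x => Unitary.toUnits (suIncl (u x))) (fun b => E b * V b) b : (Matrix (Fin 2) (Fin 2) ℂ)ˣ) : Matrix (Fin 2) (Fin 2) ℂ) =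
      (((Unitary.toUnits (suIncl (u b.src)) : (Matrix (Fin 2) (Fin 2) ℂ)ˣ) : Matrix (Fin 2) (Fin 2) ℂ) *
        ((E b : (Matrix (Fin 2) (Fin 2) ℂ)ˣ) : Matrix (Fin 2) (Fin 2) ℂ) * (((Unitary.toUnits (suIncl (u b.src)))⁻¹ : (Matrix (Fin 2) (Fin 2) ℂ)ˣ) : Matrix (Fin 2) (Fin 2) ℂ)) *
      ((gaugeActT (fun x => Unitary.toUnits (suIncl (u x))) V b : (Matrix (Fin 2) (Fin 2) ℂ)ˣ) : Matrix (Fin 2) (Fin 2) ℂ) := by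
    rw [gaugeActT_mul_bg]; simp only [Units.val_mul]
  rw [hval]
  set C : Matrix (Fin 2) (Fin 2) ℂ := ((Unitary.toUnits (suIncl (u b.src)) : (Matrix (Fin 2) (Fin 2) ℂ)ˣ) : Matrix (Fin 2) (Fin 2) ℂ) *
      ((E b : (Matrix (Fin 2) (Fin 2) ℂ)ˣ) : Matrix (Fin 2) (Fin 2) ℂ) * (((Unitary.toUnits (suIncl (u b.src)))⁻¹ : (Matrix (Fin 2) (Fin 2) ℂ)ˣ) : Matrix (Fin 2) (Fin 2) ℂ)
    with hC
  set W : Matrix (Fin 2) (Fin 2) ℂ :=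
    ((gaugeActT (fun x => Unitary.toUnits (suIncl (u x))) V b : (Matrix (Fin 2) (Fin 2) ℂ)ˣ) : Matrix (Fin 2) (Fin 2) ℂ) with hW
  -- `‖C − 1‖ ≤ s_A`: `C − 1 = û(E − 1)û⁻¹`
  have hC1 : ‖C - 1‖ ≤ sA := by
    have e1 : C - 1 = ((Unitary.toUnits (suIncl (u b.src)) : (Matrix (Fin 2) (Fin 2) ℂ)ˣ) : Matrix (Fin 2) (Fin 2) ℂ) *
        (((E b : (Matrix (Fin 2) (Fin 2) ℂ)ˣ) : Matrix (Fin 2) (Fin 2) ℂ) - 1) *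
          (((Unitary.toUnits (suIncl (u b.src)))⁻¹ : (Matrix (Fin 2) (Fin 2) ℂ)ˣ) : Matrix (Fin 2) (Fin 2) ℂ) := by
      rw [hC, mul_sub, sub_mul, mul_one, Units.mul_inv]
    rw [e1]
    calc _ ≤ ‖((Unitary.toUnits (suIncl (u b.src)) : (Matrix (Fin 2) (Fin 2) ℂ)ˣ) : Matrix (Fin 2) (Fin 2) ℂ) *
          (((E b : (Matrix (Fin 2) (Fin 2) ℂ)ˣ) : Matrix (Fin 2) (Fin 2) ℂ) - 1)‖ *
            ‖(((Unitary.toUnits (suIncl (u b.src)))⁻¹ : (Matrix (Fin 2) (Fin 2) ℂ)ˣ) : Matrix (Fin 2) (Fin 2) ℂ)‖ := norm_mul_le _ _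
      _ ≤ ‖((Unitary.toUnits (suIncl (u b.src)) : (Matrix (Fin 2) (Fin 2) ℂ)ˣ) : Matrix (Fin 2) (Fin 2) ℂ)‖ *
          ‖((E b : (Matrix (Fin 2) (Fin 2) ℂ)ˣ) : Matrix (Fin 2) (Fin 2) ℂ) - 1‖ * 1 := by
          gcongr
          · exact norm_mul_le _ _
          · exact (norm_coe_toUnits_suIncl_inv (u b.src)).le
      _ ≤ 1 * sA * 1 := by
          gcongr
          exact (norm_coe_toUnits_suIncl (u b.src)).le
      _ = sA := by ring
  -- `CW − 1 = (C − 1)(W − 1) + (C − 1) + (W − 1)`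
  have e2 : C * W - 1 = (C - 1) * (W - 1) + (C - 1) + (W - 1) := by noncomm_ring
  rw [e2]
  calc _ ≤ ‖(C - 1) * (W - 1)‖ + ‖C - 1‖ + ‖W - 1‖ := norm_add₃_le
    _ ≤ sA * sB + sA + sB := by
        gcongr
        exact (norm_mul_le _ _).trans (mul_le_mul hC1 hV (norm_nonneg _) hsA)
    _ = sA * (1 + sB) + sB := by ring

/-- **(AVG-SYM-BD) — THE k-UNIFORM SUP BOUND OF THE RELATIVE k-FOLD (0.4) AVERAGE AT A CURVED, PLAQUETTE-SMALL SU(2) BACKGROUND.**  Let `U₀` have every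
plaquette within `a₀ > 0` of `1`, `k + 1 ≤ m + K`, let the complex perturbation satisfy `‖ηA(b)‖ ≤ t ≤ 1` bondwise, and put `s_B := 2d(3Lᵏ − 1)a₀`,
`s₀ := 2t(1 + s_B) + s_B`; under the budget `6400ℓ²Lᵏs₀ ≤ 1` (ℓ = (d+2)L), for EVERY `k`-bond `e`:
`‖Ū^{(k)}[e^{iηA}·U₀♭](e) · (Ū^{(k)}[U₀♭](e))⁻¹ − 1‖ ≤ 120ℓ·Lᵏ·s₀`.
With EX's letters (`η = L^{−k}`, plaquettes `a₀ = εL^{−2k}` from `RegPr`) the right side is `120ℓ(2(1+s_B)‖A‖_sup + 6dε)`-type, independent of `k`: the input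
(BD) of the Schwarz reduction for `Chart47T3sym`.  Proof: cluster axial gauge `u = axialT U₀ (embIter k e₋)` (bonds under the blocks of `e₋, e₊` within `s_B` of
`1`), the gauged perturbed field's reads (§3), two-field relative bound (§1) for the gauged pair, and the unitary conjugation of §2.
[cite: Balaban1985Averaging, Prop. 4 (134)-(135) p.38, (11)-(12) p.19, p.24; Balaban1987RG1, (0.4)-(0.11) p.253; Balaban1985Variational, (44) p.285, (146) p.301] -/
theorem norm_relIter_sub_one_le_of_plaqSmall {k : ℕ} (hk : k + 1 ≤ P.m + P.K) (U₀ : GaugeField P 0 (Matrix.specialUnitaryGroup (Fin 2) ℂ))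
    {a₀ : ℝ} (ha₀ : 0 < a₀) (hU : PlaqSmall a₀ U₀) (η : ℝ) (A : PBond P 0 → Matrix (Fin 2) (Fin 2) ℂ) {t : ℝ} (ht1 : t ≤ 1)
    (hA : ∀ b, ‖(η : ℂ) • A b‖ ≤ t)
    (hbudget : 6400 * (((P.d + 2) * P.L : ℕ) : ℝ) ^ 2 * (P.L : ℝ) ^ k *
      (2 * t * (1 + 2 * ((P.d : ℝ) * (3 * (P.L : ℝ) ^ k - 1)) * a₀) + 2 * ((P.d : ℝ) * (3 * (P.L : ℝ) ^ k - 1)) * a₀) ≤ 1)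
    (e : PBond P k) :
    ‖((emlIterU k (fun b => expCfg η A b * unitsField (toUField U₀) b) e : (Matrix (Fin 2) (Fin 2) ℂ)ˣ) : Matrix (Fin 2) (Fin 2) ℂ) *
        (((emlIterU k (unitsField (toUField U₀)) e)⁻¹ : (Matrix (Fin 2) (Fin 2) ℂ)ˣ) : Matrix (Fin 2) (Fin 2) ℂ) - 1‖ ≤
      120 * (((P.d + 2) * P.L : ℕ) : ℝ) * (P.L : ℝ) ^ k *
        (2 * t * (1 + 2 * ((P.d : ℝ) * (3 * (P.L : ℝ) ^ k - 1)) * a₀) + 2 * ((P.d : ℝ) * (3 * (P.L : ℝ) ^ k - 1)) * a₀) := by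
  set sB : ℝ := 2 * ((P.d : ℝ) * (3 * (P.L : ℝ) ^ k - 1)) * a₀ with hsB
  set s₀ : ℝ := 2 * t * (1 + sB) + sB with hs₀
  set z := e.src with hz
  set u : GaugeTransf P 0 (Matrix.specialUnitaryGroup (Fin 2) ℂ) := axialT U₀ (embIter k z) with hu
  set û : GaugeTransf P 0 (Matrix (Fin 2) (Fin 2) ℂ)ˣ := fun x => Unitary.toUnits (suIncl (u x)) with hû
  set V₂ : GaugeField P 0 (Matrix (Fin 2) (Fin 2) ℂ)ˣ := unitsField (toUField U₀) with hV₂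
  set V₁ : GaugeField P 0 (Matrix (Fin 2) (Fin 2) ℂ)ˣ := fun b => expCfg η A b * V₂ b with hV₁
  have ht0 : 0 ≤ t := (norm_nonneg _).trans (hA ⟨embIter k e.src, e.dir⟩)
  have hL1 : (1 : ℝ) ≤ P.L := by exact_mod_cast P.L_pos
  have hsB0 : 0 ≤ sB := by
    rw [hsB]
    have h3 : (0 : ℝ) ≤ 3 * (P.L : ℝ) ^ k - 1 := by linarith [one_le_pow₀ (n := k) hL1]
    positivity
  have hs₀0 : 0 ≤ s₀ := by rw [hs₀]; positivity
  -- the cluster: both ends of `e` (corners `z`, `z + e_μ` with `μ = ν = e.dir`)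
  set S : Set (Site P k) := {w | w = z ∨ w = z.shift e.dir ∨ w = z.shift e.dir ∨ w = (z.shift e.dir).shift e.dir} with hS
  have hsrc : e.src ∈ S := Or.inl hz.symm
  have htgt : e.tgt ∈ S := Or.inr (Or.inl rfl)
  -- reads of the gauged background under the cluster (the cluster axial gauge)
  have hreads₂ : ∀ b : PBond P 0, iterBlockOf k b.src ∈ S → iterBlockOf k b.tgt ∈ S →
      ‖((gaugeActT û V₂ b : (Matrix (Fin 2) (Fin 2) ℂ)ˣ) : Matrix (Fin 2) (Fin 2) ℂ) - 1‖ ≤ sB := by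
    intro b hbs hbt
    rw [hû, hV₂, ← unitsField_toUField_gaugeActT, coe_unitsField_toUField, ← SU2Mean.dist1_eq_norm, hu]
    exact dist1_axial_cluster_le hk U₀ ha₀ hU z e.dir e.dir b hbs hbt
  -- reads of the gauged perturbed field
  have hE : ∀ b : PBond P 0, ‖((expCfg η A b : (Matrix (Fin 2) (Fin 2) ℂ)ˣ) : Matrix (Fin 2) (Fin 2) ℂ) - 1‖ ≤ 2 * t := by
    intro b
    have hI : ‖(Complex.I * (η : ℂ)) • A b‖ = ‖(η : ℂ) • A b‖ := by rw [mul_smul, norm_smul, Complex.norm_I, one_mul]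
    rw [coe_expCfg]
    calc _ ≤ 2 * ‖(Complex.I * (η : ℂ)) • A b‖ := norm_exp_sub_one_le_two_mul (by rw [hI]; exact (hA b).trans ht1)
      _ ≤ 2 * t := by rw [hI]; linarith [hA b]
  have hreads₁ : ∀ b : PBond P 0, iterBlockOf k b.src ∈ S → iterBlockOf k b.tgt ∈ S →
      ‖((gaugeActT û V₁ b : (Matrix (Fin 2) (Fin 2) ℂ)ˣ) : Matrix (Fin 2) (Fin 2) ℂ) - 1‖ ≤ s₀ := by
    intro b hbs hbt
    rw [hs₀, hV₁]
    exact norm_reads_gauged_product_le u (expCfg η A) V₂ b (hE b) (hreads₂ b hbs hbt)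
  have hreads₂' : ∀ b : PBond P 0, iterBlockOf k b.src ∈ S → iterBlockOf k b.tgt ∈ S →
      ‖((gaugeActT û V₂ b : (Matrix (Fin 2) (Fin 2) ℂ)ˣ) : Matrix (Fin 2) (Fin 2) ℂ) - 1‖ ≤ s₀ := fun b hbs hbt =>
    (hreads₂ b hbs hbt).trans (by rw [hs₀]; nlinarith)
  -- the gauged relative quantity, then undo the gauge by a unitary conjugation
  have hbud : 6400 * (((P.d + 2) * P.L : ℕ) : ℝ) ^ 2 * (P.L : ℝ) ^ k * s₀ ≤ 1 := hbudget
  have hg := norm_emlIterU_mul_inv_sub_one_le_of_reads (Nat.le_of_succ_le hk) S (gaugeActT û V₁) (gaugeActT û V₂) hs₀0 hbud hreads₁ hreads₂' e hsrc htgt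
  rw [emlIterU_mul_inv_eq_conj û V₁ V₂ k e]
  refine le_trans ?_ hg
  -- `transfUp û k e₋ = toUnits (suIncl (transfUp u k e₋))`
  have htr : ∀ (j : ℕ) (y : Site P j), transfUp û j y = Unitary.toUnits (suIncl (transfUp u j y)) := by
    intro j
    induction j with
    | zero => intro y; rfl
    | succ j ih => intro y; exact ih (emb y)
  rw [htr]
  have e1 : (((Unitary.toUnits (suIncl (transfUp u k e.src)))⁻¹ : (Matrix (Fin 2) (Fin 2) ℂ)ˣ) : Matrix (Fin 2) (Fin 2) ℂ) *
        (((emlIterU k (gaugeActT û V₁) e : (Matrix (Fin 2) (Fin 2) ℂ)ˣ) : Matrix (Fin 2) (Fin 2) ℂ) *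
          (((emlIterU k (gaugeActT û V₂) e)⁻¹ : (Matrix (Fin 2) (Fin 2) ℂ)ˣ) : Matrix (Fin 2) (Fin 2) ℂ)) *
        ((Unitary.toUnits (suIncl (transfUp u k e.src)) : (Matrix (Fin 2) (Fin 2) ℂ)ˣ) : Matrix (Fin 2) (Fin 2) ℂ) - 1 =
      (((Unitary.toUnits (suIncl (transfUp u k e.src)))⁻¹ : (Matrix (Fin 2) (Fin 2) ℂ)ˣ) : Matrix (Fin 2) (Fin 2) ℂ) *
        (((emlIterU k (gaugeActT û V₁) e : (Matrix (Fin 2) (Fin 2) ℂ)ˣ) : Matrix (Fin 2) (Fin 2) ℂ) *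
          (((emlIterU k (gaugeActT û V₂) e)⁻¹ : (Matrix (Fin 2) (Fin 2) ℂ)ˣ) : Matrix (Fin 2) (Fin 2) ℂ) - 1) *
        ((Unitary.toUnits (suIncl (transfUp u k e.src)) : (Matrix (Fin 2) (Fin 2) ℂ)ˣ) : Matrix (Fin 2) (Fin 2) ℂ) := by
    rw [mul_sub, sub_mul, mul_one, Units.inv_mul]
  rw [e1]
  exact norm_conj_su_le _ _

end SU2

end Summit.QuantumFields.YangMills.Theorems.Prop7SymAvgRelativeBound

end
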